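import Literature.NumberTheory.GaloisRepresentations.TameInertia
import Literature.NumberTheory.GaloisRepresentations.TameInertiaProofs
import Literature.NumberTheory.GaloisRepresentations.TameInertiaCyclicProofs
import Literature.NumberTheory.GaloisRepresentations.LocalGaloisGroupHenselProofs
import Literature.NumberTheory.GaloisRepresentations.AbsGaloisGroupCompact
import Mathlib.Algebra.CharP.Reduced
import Mathlib.Topology.Algebra.ClopenNhdofOne
import HarnessLib

/-!
# The wild inertia group of a non-archimedean local field (trunk GalRep, items C4/C15)

Let `F` be a non-archimedean local field with residue characteristic `p = ringChar 𝓀[F]`,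
`F̄ = AlgebraicClosure F`, `Γ_F = Gal(F̄/F)`, inertia group `I_F = absInertia F` (item C4) and a
uniformiser `ϖ`.  The maximal tamely ramified extension of `F` inside `F̄` is
`F_tr = F_nr(ϖ^{1/d} : p ∤ d)` (`F_nr` the maximal unramified extension), and the **wild
inertia group** `P_F = Gal(F̄/F_tr)` is the closed normal pro-`p` subgroup of `I_F` with
`I_F / P_F ≃ ∏_{ℓ ≠ p} ℤ_ℓ(1)` (Serre, *Local Fields*, Ch. IV §2, Cor. 1 and 3 of Prop. 7 and
Exercises 1–2; Serre, Invent. Math. 15 (1972), §1.3: `K_t = ⋃_{(d,p)=1} K_d`,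
`K_d = K_nr(π^{1/d})`, `I_p = Gal(K̄/K_t)` "le plus grand pro-`p`-groupe contenu dans `I`").

This file defines `P_F` through this explicit description of `F_tr`,

* `Literature.absWildInertia F ϖ : Subgroup Γ_F` — the elements of `I_F` fixing every `z ∈ F̄` with
  `z ^ d = ϖ`, for every `d ≥ 1` prime to `p`;

proves its elementary properties (`absWildInertia_le_absInertia`, `absWildInertia_normal`,
the description by Serre's Kummer characters `θ_d` of `ModPGaloisRep.lean`:
`mem_absWildInertia_of_kummerCharacterQuot_eq_one`, `kummerCharacterQuot_eq_one_of_mem_absWildInertia`),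
and the two consequences of `kummerCharacter_conj_apply` (`TameInertia.lean`) through which the
structure of tame inertia enters Grothendieck's `ℓ`-adic monodromy theorem
(`WeilDeligneRepMonodromyProofs.lean`):

* `Literature.NumberTheory.GaloisRepresentations.conj_mul_pow_inv_mem_absWildInertia` — **Frobenius acts on `I_F / P_F` by `u ↦ u ^ q`**:
  `τ σ τ⁻¹ σ^{-q^m} ∈ P_F` for `σ ∈ I_F` and `τ` a Frobenius power of exponent `m`
  (Serre 1972, §1.8 Prop. 6; Serre, Duke 54 (1987), §2.1: `s u s⁻¹ ≡ u^p (mod I_p)`);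
* `Literature.NumberTheory.GaloisRepresentations.commutator_mem_absWildInertia` — `I_F / P_F` is abelian.

The deep input, stated as a named fact (D-0014) **and discharged here**:

* `Literature.absWildInertia_isProP F` — **`P_F` is pro-`p`**: for `σ ∈ P_F` and every open subgroup
  `N ≤ Γ_F`, some `σ ^ (p ^ a)` lies in `N` (equivalently: the image of `P_F` in every finite
  quotient `Gal(L/F)` is a `p`-group, namely the wild ramification group `G_1(L/F)`).  This is
  the statement that every finite tamely ramified extension of `F_nr` is one of the `K_d`
  (Serre, *Local Fields*, Ch. IV §2, Cor. 1 and Cor. 3 of Prop. 7 with Exercises 1–2;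
  Serre 1972, §1.3).
* `Literature.absWildInertia_isProP_holds : absWildInertia_isProP F` — proof: shrink `N` to an open
  normal subgroup and factor through a finite Galois `Gal(E/F)` (`exists_isGalois_ker_le`,
  `TameInertiaProofs.lean`); then `σ|_E ∈ G_1(E/F)`
  (`absRestrictNormalHom_mem_ramificationSubgroup_one_of_mem_absWildInertia`: with `π` a
  uniformiser of the discrete valuation ring `O_E` (`TameInertiaCyclicProofs.lean`),
  `ϖ ~ π^e`, `e = e₀ p^w`, `p ∤ e₀`, and `z = ϖ^{1/e₀}` fixed by `σ`, the unit `y = π^{p^w}/z`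
  of `ar ℤ` gives `(σ|_E π / π)^{p^w} ≡ σ(y)/y ≡ 1 (mod 𝔓)`, hence `σ|_E π ≡ π (mod 𝔓_E²)` by
  injectivity of Frobenius on `O_E/𝔓_E`, hence `σ|_E ∈ G_1` by Serre's criterion
  `mem_ramificationSubgroup_one_of_smul_uniformizer_sub_mem`), and `G_1(E/F)` is a `p`-group
  (`isPGroup_ramificationSubgroup_one_of_isGalois`, Serre's Cor. 3).

In the tree, "wild inertia" so far only appears inside docstrings (`TameInertia.lean`, as
Serre's `I_p`; `ArtinConductor.lean`, as the closure of `⋃_{u > 0} Γ_F^u`); no declaration is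
duplicated.

## Mathlib search

Mathlib (this pin) has `Ideal.inertia`, `ValuationSubring.inertiaSubgroup`, the Krull topology
and `IsArithFrobAt`, but no wild inertia / ramification subgroup of an absolute Galois group and
no maximal tamely ramified extension (`rg -i 'wild|tamely'` in `Mathlib/RingTheory`,
`Mathlib/NumberTheory`, `Mathlib/FieldTheory`: no relevant hits).  Nothing here duplicates a
Mathlib declaration or a declaration of `TameInertia.lean` / `RamificationFiltration.lean`
(which treat the upper-numbering groups `I_F^v` and maps to discrete groups).

## Design choices

* `absWildInertia F ϖ` takes the uniformiser `ϖ : 𝒪[F]` as an explicit argument (no choice is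
  made); only `ϖ ≠ 0` or `Irreducible ϖ` is assumed where needed.  For irreducible `ϖ` the group
  does not depend on `ϖ` (two uniformisers differ by a unit of `𝒪[F]`, whose prime-to-`p` roots
  generate unramified extensions); this independence is not needed downstream and not stated.
* The named fact is phrased with open subgroups of `Γ_F` ("`σ^{p^a} → 1`"), the form consumed by
  the monodromy theorem; no quotient groups or `IsPGroup` are needed to state it.

## References

* [SerreLocalFields1979] J.-P. Serre, *Local Fields*, GTM 67, Springer 1979, Ch. IV §2, Prop. 7,
  Cor. 1 ("`G_0/G_1` is cyclic of order prime to `p`"), Cor. 3 ("`G_1` is a `p`-group"),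
  Exercises 1–2 (`G_0`, `G_1` of an infinite extension; `G_0/G_1 ≃ lim← μ_n`, compatible with
  the action of `G/G_0`).
* [SerreInventiones1972] J.-P. Serre, *Propriétés galoisiennes des points d'ordre fini des courbes
  elliptiques*, Invent. Math. 15 (1972), §1.3 (`I_p`, `I_t = I/I_p = lim← μ_d`, `K_d`, `K_t`),
  §1.8, Prop. 6.
* [Serre1987] J.-P. Serre, *Sur les représentations modulaires de degré 2 de `Gal(ℚ̄/ℚ)`*,
  Duke Math. J. 54 (1987), §2.1.
-/

noncomputable section

open scoped Pointwise Valued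
open Field ValuativeRel

namespace Literature.NumberTheory.GaloisRepresentations

open GaloisRepresentations.IsNonarchimedeanLocalField

universe u

variable (F : Type u) [Field F] [ValuativeRel F] [TopologicalSpace F] [IsNonarchimedeanLocalField F]

/-- The **wild inertia group** `P_F = Gal(F̄ / F_nr(ϖ^{1/d} : p ∤ d)) ≤ I_F` of the
non-archimedean local field `F` (for a uniformiser `ϖ`): the elements of the inertia group
`I_F = absInertia F` fixing every `d`-th root of `ϖ` in `F̄`, for every `d ≥ 1` prime to the
residue characteristic `p = ringChar 𝓀[F]`.  Since `F_tr = F_nr(ϖ^{1/d} : p ∤ d)` is the maximal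
tamely ramified extension of `F`, this is the wild inertia group, the closed normal pro-`p`
subgroup of `I_F` with tame quotient `I_F / P_F ≃ lim← μ_d ≃ ∏_{ℓ ≠ p} ℤ_ℓ(1)`.
Ref: Serre, Invent. Math. 15 (1972), §1.3 (`K_d = K_nr(x^{1/d})`, `K_t = ⋃ K_d`,
`I_p = Gal(K̄/K_t)`); Serre, *Local Fields*, Ch. IV §2, Exercises 1–2.
[cite: SerreInventiones1972, §1.3] -/
def absWildInertia (ϖ : 𝒪[F]) : Subgroup (absoluteGaloisGroup F) where
  carrier := {σ | σ ∈ absInertia F ∧ ∀ ⦃d : ℕ⦄, 0 < d → ¬ ringChar 𝓀[F] ∣ d →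
      ∀ z : AlgebraicClosure F, z ^ d = algebraMap 𝒪[F] (AlgebraicClosure F) ϖ → σ • z = z}
  one_mem' := ⟨one_mem _, fun _ _ _ z _ => one_smul _ z⟩
  mul_mem' := by
    rintro σ τ ⟨hσ, hσ'⟩ ⟨hτ, hτ'⟩
    exact ⟨mul_mem hσ hτ, fun d hd hpd z hz => by rw [mul_smul, hτ' hd hpd z hz, hσ' hd hpd z hz]⟩
  inv_mem' := by
    rintro σ ⟨hσ, hσ'⟩
    refine ⟨inv_mem hσ, fun d hd hpd z hz => ?_⟩
    calc σ⁻¹ • z = σ⁻¹ • σ • z := by rw [hσ' hd hpd z hz]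
      _ = z := inv_smul_smul σ z

variable {F}

/-- Membership in the wild inertia group `absWildInertia F ϖ` (unfolding lemma).
Ref: Serre, Invent. Math. 15 (1972), §1.3. [cite: SerreInventiones1972, §1.3] -/
theorem mem_absWildInertia_iff {ϖ : 𝒪[F]} {σ : absoluteGaloisGroup F} :
    σ ∈ absWildInertia F ϖ ↔ σ ∈ absInertia F ∧ ∀ ⦃d : ℕ⦄, 0 < d → ¬ ringChar 𝓀[F] ∣ d →
      ∀ z : AlgebraicClosure F, z ^ d = algebraMap 𝒪[F] (AlgebraicClosure F) ϖ → σ • z = z :=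
  Iff.rfl

variable (F) in
/-- `P_F ≤ I_F`.  Ref: Serre, Invent. Math. 15 (1972), §1.3. [cite: SerreInventiones1972, §1.3] -/
theorem absWildInertia_le_absInertia (ϖ : 𝒪[F]) : absWildInertia F ϖ ≤ absInertia F :=
  fun _ h => h.1

variable (F) in
/-- `P_F` is a normal subgroup of `Γ_F` (`F_tr / F` is Galois: `τ⁻¹` permutes the `d`-th roots
of `ϖ ∈ F`, and `I_F ⊴ Γ_F`, `absInertia_normal_holds`).
Ref: Serre, Invent. Math. 15 (1972), §1.3. [cite: SerreInventiones1972, §1.3] -/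
theorem absWildInertia_normal (ϖ : 𝒪[F]) : (absWildInertia F ϖ).Normal := by
  haveI : (absInertia F).Normal := absInertia_normal_holds F
  refine ⟨fun σ hσ τ => ⟨Subgroup.Normal.conj_mem inferInstance σ hσ.1 τ, fun d hd hpd z hz => ?_⟩⟩
  have hz' : (τ⁻¹ • z) ^ d = algebraMap 𝒪[F] (AlgebraicClosure F) ϖ := by
    rw [← smul_pow', hz, smul_algebraMap_valuationInteger]
  rw [mul_smul, mul_smul, hσ.2 hd hpd _ hz', smul_inv_smul]

variable (F) in
/-- **The wild inertia group is pro-`p`** (named fact, D-0014).  For a uniformiser `ϖ` of `F`,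
every `σ ∈ P_F = absWildInertia F ϖ = Gal(F̄ / F_nr(ϖ^{1/d} : p ∤ d))` and every open subgroup
`N ≤ Γ_F`, there is an `a` with `σ ^ (p ^ a) ∈ N`, `p = ringChar 𝓀[F]`; equivalently the image
of `P_F` in every finite quotient `Gal(L/F)` of `Γ_F` is a `p`-group (it is the wild ramification
group `G_1(L/F)`).  Content: `F_nr(ϖ^{1/d} : p ∤ d)` is the *maximal* tamely ramified extension
`F_tr` of `F`, i.e. every finite Galois `L/F` with `p`-free ramification index `e` satisfies
`L F_nr = F_nr(ϖ^{1/e})` (`G_0/G_1` is cyclic of order prime to `p` and `θ_0 : G_0/G_1 ↪ μ`,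
Kummer theory over `F_nr`), and `Gal(F̄/F_tr) = lim← G_1(L/F)` with `G_1(L/F)` a `p`-group.
Discharged below: `absWildInertia_isProP_holds`.
Ref: Serre, *Local Fields*, Ch. IV §2, Cor. 1 and Cor. 3 of Prop. 7, and Exercises 1–2
(`G_1` of `Gal(K_s/K)` as a projective limit; `G_0/G_1 ≃ lim← μ_n`); Serre, Invent. Math. 15
(1972), §1.3 ("`I_p` … le plus grand pro-`p`-groupe contenu dans `I`", `K_t = ⋃ K_d`).
[cite: SerreLocalFields1979, Ch. IV §2 Cor. 1 and Cor. 3 of Prop. 7, Exercises 1–2]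
[cite: SerreInventiones1972, §1.3] -/
def absWildInertia_isProP : Prop :=
  ∀ ⦃ϖ : 𝒪[F]⦄ (_hϖ : Irreducible ϖ) ⦃σ : absoluteGaloisGroup F⦄ (_hσ : σ ∈ absWildInertia F ϖ)
    (N : Subgroup (absoluteGaloisGroup F)) (_hN : IsOpen (N : Set (absoluteGaloisGroup F))),
    ∃ a : ℕ, σ ^ (ringChar 𝓀[F] ^ a) ∈ N

/-! ### Roots of unity of order prime to `p` are fixed by inertia -/

/-- An element of the inertia group fixes every root of unity `ζ ∈ F̄` of order prime to `p`:
`η = σ(ζ)/ζ` is a `d`-th root of unity with `η ≡ 1 (mod 𝔓)`, hence `η = 1`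
(`eq_one_of_pow_eq_one_of_sub_one_mem`: roots of unity of order prime to `p` are distinct
modulo `𝔓`).  Ref: Serre, Invent. Math. 15 (1972), §1.3 (`μ_d ≃ μ_d(k_s)` by reduction);
Serre, *Local Fields*, Ch. IV §4, Prop. 16. [cite: SerreInventiones1972, §1.3] -/
theorem smul_eq_self_of_pow_eq_one_of_mem_absInertia {σ : absoluteGaloisGroup F}
    (hσ : σ ∈ absInertia F) {d : ℕ} (hd : 0 < d) (hpd : ¬ ringChar 𝓀[F] ∣ d)
    {ζ : AlgebraicClosure F} (hζ : ζ ^ d = 1) : σ • ζ = ζ := by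
  have hζint : IsIntegral 𝒪[F] ζ := IsIntegral.of_pow hd (by rw [hζ]; exact isIntegral_one)
  set ζS : absIntegers 𝒪[F] F := ⟨ζ, hζint⟩ with hζS
  have hζSd : ζS ^ d = 1 := Subtype.ext (by simp [hζS, hζ])
  have hζS1 : ζS * ζS ^ (d - 1) = 1 := by
    rw [← pow_succ', Nat.sub_add_cancel hd, hζSd]
  have hζS0 : ζS ^ (d - 1) ≠ 0 := fun h => by simp [h] at hζS1
  -- `η = σ(ζ) ζ^{d-1} = σ(ζ)/ζ`
  set η : absIntegers 𝒪[F] F := σ • ζS * ζS ^ (d - 1) with hη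
  have hηd : η ^ d = 1 := by
    rw [hη, mul_pow, ← smul_pow', hζSd, smul_one, one_mul, ← pow_mul, mul_comm, pow_mul, hζSd,
      one_pow]
  have hη1 : η - 1 ∈ absMaximalIdeal F := by
    have : η - 1 = (σ • ζS - ζS) * ζS ^ (d - 1) := by rw [sub_mul, hζS1]
    rw [this]
    exact Ideal.mul_mem_right _ _ (hσ ζS)
  have hQ : absMaximalIdeal F ≠ ⊤ := (absMaximalIdeal_isMaximal_holds F).ne_top
  have hη' : η = 1 := eq_one_of_pow_eq_one_of_sub_one_mem hQ hd hpd hηd hη1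
  -- cancel `ζ^{d-1}`
  have hfix : σ • ζS = ζS := by
    apply mul_right_cancel₀ hζS0
    rw [← hη, hη', hζS1]
  have := congrArg (fun x : absIntegers 𝒪[F] F => (x : AlgebraicClosure F)) hfix
  simpa [hζS] using this

/-! ### Description by the Kummer characters `θ_d` -/

/-- **`P_F` is the common kernel of the Kummer characters `θ_d`, `p ∤ d`** (sufficiency): if
`σ ∈ I_F` satisfies `θ_d(σ) = 1` in `S ⧸ 𝔓` (`kummerCharacterQuot`, for the chosen `d`-th root
`z_d` of `ϖ ≠ 0`) for every `d ≥ 1` prime to `p`, then `σ` fixes *every* `d`-th root of `ϖ`: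
`σ(z_d)/z_d` is a `d`-th root of unity `≡ 1 (mod 𝔓)`, hence `= 1`, and any other root is
`ζ z_d` with `ζ ∈ μ_d` fixed by inertia.
Ref: Serre, Invent. Math. 15 (1972), §1.3 (`θ_d : Gal(K_d/K_nr) ≃ μ_d` by reduction).
[cite: SerreInventiones1972, §1.3] -/
theorem mem_absWildInertia_of_kummerCharacterQuot_eq_one {ϖ : 𝒪[F]} (hϖ0 : ϖ ≠ 0)
    {σ : absoluteGaloisGroup F} (hσ : σ ∈ absInertia F)
    (h : ∀ ⦃d : ℕ⦄ (hd : 0 < d), ¬ ringChar 𝓀[F] ∣ d → kummerCharacterQuot F hd hϖ0 ⟨σ, hσ⟩ = 1) :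
    σ ∈ absWildInertia F ϖ := by
  refine ⟨hσ, fun d hd hpd z hz => ?_⟩
  -- the chosen root `z₀`
  have hz₀ := coe_kummerRoot_pow F hd ϖ
  have hz₀0 : (kummerRoot F hd ϖ : AlgebraicClosure F) ≠ 0 := coe_kummerRoot_ne_zero hd hϖ0
  have hQ : absMaximalIdeal F ≠ ⊤ := (absMaximalIdeal_isMaximal_holds F).ne_top
  -- `σ z₀ / z₀ = 1`
  have hc1 : kummerCocycleInt F hd hϖ0 σ - 1 ∈ absMaximalIdeal F := by
    rw [← Ideal.Quotient.eq, map_one]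
    exact h hd hpd
  have hc : kummerCocycleInt F hd hϖ0 σ = 1 :=
    eq_one_of_pow_eq_one_of_sub_one_mem hQ hd hpd (kummerCocycleInt_pow hd hϖ0 σ) hc1
  have hfix₀ : σ • (kummerRoot F hd ϖ : AlgebraicClosure F) = kummerRoot F hd ϖ := by
    have := congrArg (fun x : absIntegers 𝒪[F] F => (x : AlgebraicClosure F)) hc
    simp only [coe_kummerCocycleInt, kummerCocycle, OneMemClass.coe_one] at this
    exact (div_eq_one_iff_eq hz₀0).mp this
  -- `z = ζ z₀` with `ζ ^ d = 1`
  have hϖ' : algebraMap 𝒪[F] (AlgebraicClosure F) ϖ ≠ 0 := by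
    rw [← hz₀]; exact pow_ne_zero _ hz₀0
  set ζ := z / kummerRoot F hd ϖ with hζ
  have hζd : ζ ^ d = 1 := by rw [hζ, div_pow, hz, hz₀, div_self hϖ']
  have hzζ : z = ζ * kummerRoot F hd ϖ := by rw [hζ, div_mul_cancel₀ _ hz₀0]
  rw [hzζ, smul_mul', smul_eq_self_of_pow_eq_one_of_mem_absInertia hσ hd hpd hζd, hfix₀]

/-- **`P_F` is the common kernel of the Kummer characters `θ_d`, `p ∤ d`** (necessity):
`θ_d(σ) = 1` for `σ ∈ P_F` (it fixes the chosen `d`-th root of `ϖ`).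
Ref: Serre, Invent. Math. 15 (1972), §1.3. [cite: SerreInventiones1972, §1.3] -/
theorem kummerCharacterQuot_eq_one_of_mem_absWildInertia {ϖ : 𝒪[F]} (hϖ0 : ϖ ≠ 0)
    {σ : absoluteGaloisGroup F} (hσ : σ ∈ absWildInertia F ϖ) {d : ℕ} (hd : 0 < d)
    (hpd : ¬ ringChar 𝓀[F] ∣ d) : kummerCharacterQuot F hd hϖ0 ⟨σ, hσ.1⟩ = 1 := by
  have hfix : σ • (kummerRoot F hd ϖ : AlgebraicClosure F) = kummerRoot F hd ϖ :=
    hσ.2 hd hpd _ (coe_kummerRoot_pow F hd ϖ)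
  have hc : kummerCocycleInt F hd hϖ0 σ = 1 := Subtype.ext (by
    rw [coe_kummerCocycleInt, kummerCocycle, hfix, div_self (coe_kummerRoot_ne_zero hd hϖ0),
      OneMemClass.coe_one])
  change Ideal.Quotient.mk _ (kummerCocycleInt F hd hϖ0 σ) = 1
  rw [hc, map_one]

/-! ### Frobenius acts on tame inertia by `u ↦ u ^ q`; tame inertia is abelian -/

/-- The `S ⧸ 𝔓`-valued form of `kummerCharacter_conj_apply` (`TameInertia.lean`):
`θ_d(τ σ τ⁻¹) = θ_d(σ) ^ (q ^ m)` in `S ⧸ 𝔓` for `σ ∈ I_F` and `τ` a Frobenius power of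
exponent `m` (take `k = S ⧸ 𝔓`, a field by `absMaximalIdeal_isMaximal_holds`, and `ι = id`).
Ref: Serre, Invent. Math. 15 (1972), §1.8, Prop. 6; Serre, Duke Math. J. 54 (1987), §2.1.
[cite: SerreInventiones1972, §1.8 Prop. 6] -/
theorem kummerCharacterQuot_conj_apply {d : ℕ} (hd : 0 < d) {a : 𝒪[F]} (ha : a ≠ 0)
    {τ : absoluteGaloisGroup F} {m : ℕ} (hτ : IsFrobPow τ m) (σ : absInertia F)
    (h : τ * (σ : absoluteGaloisGroup F) * τ⁻¹ ∈ absInertia F) :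
    kummerCharacterQuot F hd ha ⟨τ * σ * τ⁻¹, h⟩ =
      kummerCharacterQuot F hd ha σ ^ (residueFieldCard F ^ m) := by
  haveI : (absMaximalIdeal F).IsMaximal := absMaximalIdeal_isMaximal_holds F
  letI : Field (absIntegers 𝒪[F] F ⧸ absMaximalIdeal F) := Ideal.Quotient.field _
  have key := kummerCharacter_conj_apply (k := absIntegers 𝒪[F] F ⧸ absMaximalIdeal F) hd ha
    (RingHom.id _) hτ σ h
  simp only [coe_kummerCharacter_apply, RingHom.id_apply] at key
  exact key

/-- **Frobenius acts on the tame inertia `I_F / P_F` by `u ↦ u ^ (q ^ m)`**: for `σ ∈ I_F` and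
`τ ∈ Γ_F` a Frobenius power of exponent `m` (`IsFrobPow τ m`; e.g. an arithmetic Frobenius,
`m = 1`), `τ σ τ⁻¹ σ^{-(q^m)} ∈ P_F` (`q = residueFieldCard F`).  This is Serre's
"`s u s⁻¹ ≡ u^q (mod I_p)`", obtained from `kummerCharacter_conj_apply`
(`θ_d(τστ⁻¹) = θ_d(σ)^{q^m}` for all `d`) and the description of `P_F` as the common kernel
of the `θ_d`, `p ∤ d`.  Only `ϖ ≠ 0` is used.
Ref: Serre, Invent. Math. 15 (1972), §1.8, Prop. 6; Serre, Duke Math. J. 54 (1987), §2.1;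
Serre, *Local Fields*, Ch. IV §2, Exercise 2(b).  [cite: SerreInventiones1972, §1.8 Prop. 6] -/
theorem conj_mul_pow_inv_mem_absWildInertia {ϖ : 𝒪[F]} (hϖ0 : ϖ ≠ 0)
    {τ : absoluteGaloisGroup F} {m : ℕ} (hτ : IsFrobPow τ m)
    {σ : absoluteGaloisGroup F} (hσ : σ ∈ absInertia F) :
    τ * σ * τ⁻¹ * (σ ^ residueFieldCard F ^ m)⁻¹ ∈ absWildInertia F ϖ := by
  haveI : (absInertia F).Normal := absInertia_normal_holds F
  have h1 : τ * σ * τ⁻¹ ∈ absInertia F := Subgroup.Normal.conj_mem inferInstance σ hσ τ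
  have hx : τ * σ * τ⁻¹ * (σ ^ residueFieldCard F ^ m)⁻¹ ∈ absInertia F :=
    mul_mem h1 (inv_mem (pow_mem hσ _))
  refine mem_absWildInertia_of_kummerCharacterQuot_eq_one hϖ0 hx fun d hd hpd => ?_
  have key := kummerCharacterQuot_conj_apply hd hϖ0 hτ ⟨σ, hσ⟩ h1
  -- pass to the units-valued character to divide
  set θ := (kummerCharacterQuot F hd hϖ0).toHomUnits with hθ
  have hθv : ∀ x, (θ x : absIntegers 𝒪[F] F ⧸ absMaximalIdeal F) = kummerCharacterQuot F hd hϖ0 x :=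
    fun x => rfl
  have hxe : (⟨τ * σ * τ⁻¹ * (σ ^ residueFieldCard F ^ m)⁻¹, hx⟩ : absInertia F) =
      ⟨τ * σ * τ⁻¹, h1⟩ * ((⟨σ, hσ⟩ : absInertia F) ^ residueFieldCard F ^ m)⁻¹ := rfl
  have key' : θ ⟨τ * σ * τ⁻¹, h1⟩ = θ ⟨σ, hσ⟩ ^ residueFieldCard F ^ m :=
    Units.ext (by rw [Units.val_pow_eq_pow_val, hθv, hθv, key])
  have : θ ⟨τ * σ * τ⁻¹ * (σ ^ residueFieldCard F ^ m)⁻¹, hx⟩ = 1 := by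
    rw [hxe, map_mul, map_inv, map_pow, key', mul_inv_cancel]
  rw [← hθv, this, Units.val_one]

/-- **The tame inertia `I_F / P_F` is abelian**: commutators of elements of `I_F` lie in `P_F`
(every `θ_d` is a homomorphism to the commutative group `(S ⧸ 𝔓)ˣ`).
Ref: Serre, Invent. Math. 15 (1972), §1.3 (`I_t` "groupe profini commutatif");
Serre, *Local Fields*, Ch. IV §2, Cor. 1 of Prop. 7. [cite: SerreInventiones1972, §1.3] -/
theorem commutator_mem_absWildInertia {ϖ : 𝒪[F]} (hϖ0 : ϖ ≠ 0)
    {σ₁ σ₂ : absoluteGaloisGroup F} (h₁ : σ₁ ∈ absInertia F) (h₂ : σ₂ ∈ absInertia F) :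
    σ₁ * σ₂ * σ₁⁻¹ * σ₂⁻¹ ∈ absWildInertia F ϖ := by
  have hx : σ₁ * σ₂ * σ₁⁻¹ * σ₂⁻¹ ∈ absInertia F :=
    mul_mem (mul_mem (mul_mem h₁ h₂) (inv_mem h₁)) (inv_mem h₂)
  refine mem_absWildInertia_of_kummerCharacterQuot_eq_one hϖ0 hx fun d hd hpd => ?_
  set θ := (kummerCharacterQuot F hd hϖ0).toHomUnits with hθ
  have hθv : ∀ x, (θ x : absIntegers 𝒪[F] F ⧸ absMaximalIdeal F) = kummerCharacterQuot F hd hϖ0 x :=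
    fun x => rfl
  have hxe : (⟨σ₁ * σ₂ * σ₁⁻¹ * σ₂⁻¹, hx⟩ : absInertia F) =
      ⟨σ₁, h₁⟩ * ⟨σ₂, h₂⟩ * (⟨σ₁, h₁⟩ : absInertia F)⁻¹ * (⟨σ₂, h₂⟩ : absInertia F)⁻¹ := rfl
  have : θ ⟨σ₁ * σ₂ * σ₁⁻¹ * σ₂⁻¹, hx⟩ = 1 := by
    rw [hxe, map_mul, map_mul, map_mul, map_inv, map_inv, mul_comm (θ ⟨σ₁, h₁⟩) (θ ⟨σ₂, h₂⟩)]
    group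
  rw [← hθv, this, Units.val_one]

/-! ### Discharge of `absWildInertia_isProP`: finite level `Gal(E/F)`, `σ|_E ∈ G_1` -/

section Discharge

variable (F)

-- the residue-field bookkeeping is heavy; give the kernel room (as in `TameInertiaCyclicProofs`)
set_option maxHeartbeats 800000 in
/-- **Serre's criterion for `G_1` at a uniformiser** (finite Galois `E/F` inside `F̄`, `O_E` the
integral closure of `𝒪[F]` in `E`, a discrete valuation ring with maximal ideal `𝔓_E = 𝔓 ∩ E`
and uniformiser `π`): if `τ ∈ G_0` satisfies `τ π ≡ π (mod 𝔓_E²)` then `τ ∈ G_1`, i.e.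
`τ x ≡ x (mod 𝔓_E²)` for *all* `x ∈ O_E`.  (Write `x = x^{q'} + a π` with `q' = #(O_E ⧸ 𝔓_E)`;
`τ(x^{q'}) - x^{q'} = (x + n)^{q'} - x^{q'} ∈ 𝔓_E²` for `n = τ x - x ∈ 𝔓_E` as `q' ∈ 𝔓_E`, and
`τ(aπ) - aπ = τ(a)(τπ - π) + (τa - a)π ∈ 𝔓_E²`.)  This is the argument of
`exists_inertiaCharacter` (`TameInertiaCyclicProofs.lean`, kernel of `θ₀`), isolated.
Ref: Serre, *Local Fields*, Ch. IV §2, Prop. 7 (`i = 0`) and §1, Lemma 1.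
[cite: SerreLocalFields1979, Ch. IV §2 Prop. 7] -/
theorem mem_ramificationSubgroup_one_of_smul_uniformizer_sub_mem
    (E : IntermediateField F (AlgebraicClosure F)) [FiniteDimensional F E] [IsGalois F E]
    {π : integralClosure 𝒪[F] E} (hπ : Irreducible π) {τ : E ≃ₐ[F] E}
    (hτI : τ ∈ ((absMaximalIdeal F).comap (E.integralClosureToAbsIntegers 𝒪[F])).inertia (E ≃ₐ[F] E))
    (hτπ : τ • π - π ∈ ((absMaximalIdeal F).comap (E.integralClosureToAbsIntegers 𝒪[F])) ^ 2) :
    τ ∈ ((absMaximalIdeal F).comap (E.integralClosureToAbsIntegers 𝒪[F])).ramificationSubgroup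
      (E ≃ₐ[F] E) 1 := by
  classical
  set Q : Ideal (integralClosure 𝒪[F] E) :=
    (absMaximalIdeal F).comap (E.integralClosureToAbsIntegers 𝒪[F]) with hQdef
  haveI hDVR : IsDiscreteValuationRing (integralClosure 𝒪[F] E) :=
    isDiscreteValuationRing_integralClosure F E
  haveI : (absMaximalIdeal F).IsMaximal := absMaximalIdeal_isMaximal_holds F
  haveI hQmax : Q.IsMaximal := isMaximal_comap_integralClosureToAbsIntegers 𝒪[F] (absMaximalIdeal F) E
  have hmQ : IsLocalRing.maximalIdeal (integralClosure 𝒪[F] E) = Q :=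
    (IsLocalRing.eq_maximalIdeal hQmax).symm
  have hQπ : Q = Ideal.span {π} := by rw [← hmQ]; exact hπ.maximalIdeal_eq
  have hπQ : π ∈ Q := by rw [hQπ]; exact Ideal.mem_span_singleton_self π
  have hstab : τ • Q = Q := smul_comap_absMaximalIdeal F E τ
  rw [Ideal.mem_ramificationSubgroup_iff]
  refine ⟨hstab, fun x => ?_⟩
  -- finite residue field: `x ^ q' ≡ x` and `q' ∈ Q`
  haveI : Finite (integralClosure 𝒪[F] E ⧸ Q) := finite_integralClosure_quotient F E
  letI : Fintype (integralClosure 𝒪[F] E ⧸ Q) := Fintype.ofFinite _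
  obtain ⟨q', hq'⟩ : ∃ q' : ℕ, q' = Fintype.card (integralClosure 𝒪[F] E ⧸ Q) := ⟨_, rfl⟩
  have hxq : x - x ^ q' ∈ Q := by
    letI : Field (integralClosure 𝒪[F] E ⧸ Q) := Ideal.Quotient.field Q
    rw [← Ideal.Quotient.eq, map_pow, hq', FiniteField.pow_card]
  have hq'Q : ((q' : ℕ) : integralClosure 𝒪[F] E) ∈ Q := by
    letI : Field (integralClosure 𝒪[F] E ⧸ Q) := Ideal.Quotient.field Q
    rw [← Ideal.Quotient.eq_zero_iff_mem, map_natCast, hq', FiniteField.cast_card_eq_zero]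
  -- (1) `τ (x ^ q') - x ^ q' ∈ Q ^ 2`
  obtain ⟨n, hn⟩ : ∃ n : integralClosure 𝒪[F] E, n = τ • x - x := ⟨_, rfl⟩
  have hnQ : n ∈ Q := by rw [hn]; exact hτI x
  have h1 : τ • (x ^ q') - x ^ q' ∈ Q ^ 2 := by
    have hsx : τ • x = x + n := by rw [hn]; ring
    obtain ⟨r, hr⟩ := sq_dvd_add_pow_sub_sub n x q'
    have hkey : τ • (x ^ q') - x ^ q' = x ^ (q' - 1) * n * q' + n ^ 2 * r := by
      rw [smul_pow', hsx]
      linear_combination hr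
    rw [hkey, pow_two, pow_two]
    refine Ideal.add_mem _ ?_ (Ideal.mul_mem_right _ _ (Ideal.mul_mem_mul hnQ hnQ))
    have : x ^ (q' - 1) * n * (q' : integralClosure 𝒪[F] E) =
        (x ^ (q' - 1)) * (n * (q' : integralClosure 𝒪[F] E)) := by ring
    rw [this]
    exact Ideal.mul_mem_left _ _ (Ideal.mul_mem_mul hnQ hq'Q)
  -- (2) `τ m - m ∈ Q ^ 2` for `m = x - x ^ q' = a * π`
  obtain ⟨a, ha⟩ : ∃ a, a * π = x - x ^ q' := by
    rw [hQπ] at hxq; exact Ideal.mem_span_singleton'.mp hxq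
  have h2 : τ • (x - x ^ q') - (x - x ^ q') ∈ Q ^ 2 := by
    have hkey : τ • (x - x ^ q') - (x - x ^ q') = τ • a * (τ • π - π) + (τ • a - a) * π := by
      rw [← ha, smul_mul']; ring
    rw [hkey]
    refine Ideal.add_mem _ (Ideal.mul_mem_left _ _ hτπ) ?_
    rw [pow_two]
    exact Ideal.mul_mem_mul (hτI a) hπQ
  have hsplit : τ • x - x = (τ • (x ^ q') - x ^ q') + (τ • (x - x ^ q') - (x - x ^ q')) := by
    rw [smul_sub]; ring
  rw [show (1 : ℕ) + 1 = 2 by rfl, hsplit]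
  exact Ideal.add_mem _ h1 h2

set_option maxHeartbeats 800000 in
/-- **An element of `P_F` restricts into the wild ramification group `G_1(E/F)`** of every
finite Galois subextension `E/F` of `F̄`.  Let `τ = σ|_E`, `π` a uniformiser of `O_E`,
`ϖ = u π^e` with `e = e₀ p^w`, `p ∤ e₀`, and `c = τ(π)/π ∈ O_E`.  As `σ` fixes an `e₀`-th
root `z` of `ϖ`, the element `y = π^{p^w} / z` (a unit of `\bar ℤ`: `y^{e₀} = u⁻¹`) satisfies
`σ(y)/y = c^{p^w}`, and `σ(y) ≡ y (mod 𝔓)` since `σ ∈ I_F`; so `c^{p^w} ≡ 1 (mod 𝔓_E)`.  As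
the `p`-power map of the residue field `O_E ⧸ 𝔓_E` (characteristic `p`) is injective, `c ≡ 1`,
`τ π ≡ π (mod 𝔓_E²)`, and `τ ∈ G_1` by
`mem_ramificationSubgroup_one_of_smul_uniformizer_sub_mem`.  This is the classical fact that
the tame part of the ramification of `E/F` is absorbed by `F(ϖ^{1/e₀})` (Abhyankar).
Ref: Serre, *Local Fields*, Ch. IV §2, Prop. 7 and Cor. 1; Serre, Invent. Math. 15 (1972),
§1.3. [cite: SerreLocalFields1979, Ch. IV §2 Prop. 7 and Cor. 1] -/
theorem absRestrictNormalHom_mem_ramificationSubgroup_one_of_mem_absWildInertia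
    (E : IntermediateField F (AlgebraicClosure F)) [FiniteDimensional F E] [IsGalois F E]
    {ϖ : 𝒪[F]} (hϖ : Irreducible ϖ) {σ : absoluteGaloisGroup F} (hσ : σ ∈ absWildInertia F ϖ) :
    absRestrictNormalHom (K := F) E σ ∈
      ((absMaximalIdeal F).comap (E.integralClosureToAbsIntegers 𝒪[F])).ramificationSubgroup
        (E ≃ₐ[F] E) 1 := by
  classical
  set O := integralClosure 𝒪[F] E with hO
  set ι := E.integralClosureToAbsIntegers 𝒪[F] with hιdef
  set Q : Ideal O := (absMaximalIdeal F).comap ι with hQdef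
  set τ : E ≃ₐ[F] E := absRestrictNormalHom (K := F) E σ with hτdef
  haveI hDVR : IsDiscreteValuationRing O := isDiscreteValuationRing_integralClosure F E
  haveI hPmax : (absMaximalIdeal F).IsMaximal := absMaximalIdeal_isMaximal_holds F
  haveI hQmax : Q.IsMaximal := isMaximal_comap_integralClosureToAbsIntegers 𝒪[F] (absMaximalIdeal F) E
  have hmQ : IsLocalRing.maximalIdeal O = Q := (IsLocalRing.eq_maximalIdeal hQmax).symm
  have hp : (ringChar 𝓀[F]).Prime := ringChar_residueField_prime (F := F)
  -- a uniformiser `π`, `Q = (π)`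
  obtain ⟨π, hπ⟩ := IsDiscreteValuationRing.exists_irreducible O
  have hQπ : Q = Ideal.span {π} := by rw [← hmQ]; exact hπ.maximalIdeal_eq
  have hπQ : π ∈ Q := by rw [hQπ]; exact Ideal.mem_span_singleton_self π
  have hπ0 : π ≠ 0 := hπ.ne_zero
  -- equivariance `ι (τ • x) = σ • ι x` and `τ ∈ G_0`
  have hιτ : ∀ x : O, ι (τ • x) = σ • ι x := fun x =>
    IntermediateField.integralClosureToAbsIntegers_restrictNormalHom_smul 𝒪[F] E σ x
  have hτI : τ ∈ Q.inertia (E ≃ₐ[F] E) := by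
    intro x
    rw [Submodule.mem_toAddSubgroup, hQdef, Ideal.mem_comap, map_sub, hιτ]
    exact hσ.1 (ι x)
  have hstab : τ • Q = Q := smul_comap_absMaximalIdeal F E τ
  -- `c` with `c * π = τ • π`
  obtain ⟨c, hc⟩ : ∃ c : O, c * π = τ • π :=
    Ideal.mem_span_singleton'.mp (by rw [← hQπ, ← hstab]; exact Ideal.smul_mem_pointwise_smul τ π Q hπQ)
  -- `ϖ = u π ^ e` in `O`, `e = e₀ p^w ≠ 0`
  have hinj : Function.Injective (algebraMap 𝒪[F] O) := by
    intro a b hab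
    have := congrArg (fun y : O => ((y : E) : AlgebraicClosure F)) hab
    simp only [Subalgebra.coe_algebraMap] at this
    change algebraMap 𝒪[F] (AlgebraicClosure F) a = algebraMap 𝒪[F] (AlgebraicClosure F) b at this
    rw [IsScalarTower.algebraMap_apply 𝒪[F] F (AlgebraicClosure F),
      IsScalarTower.algebraMap_apply 𝒪[F] F (AlgebraicClosure F)] at this
    exact IsFractionRing.injective 𝒪[F] F ((algebraMap F (AlgebraicClosure F)).injective this)
  have hϖO0 : algebraMap 𝒪[F] O ϖ ≠ 0 := (map_ne_zero_iff _ hinj).mpr hϖ.ne_zero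
  have hϖOQ : algebraMap 𝒪[F] O ϖ ∈ Q := by
    rw [hQdef, ← Ideal.mem_comap, ← Ideal.under_def, under_comap_integralClosureToAbsIntegers,
      under_absMaximalIdeal_holds]
    exact (IsLocalRing.mem_maximalIdeal _).mpr hϖ.not_isUnit
  obtain ⟨e, u, hu⟩ : ∃ (e : ℕ) (u : Oˣ), algebraMap 𝒪[F] O ϖ * u = π ^ e := by
    obtain ⟨e, he⟩ := IsDiscreteValuationRing.associated_pow_irreducible hϖO0 hπ
    obtain ⟨u, hu⟩ := he
    exact ⟨e, u, hu⟩
  have he0 : e ≠ 0 := by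
    rintro rfl
    rw [pow_zero] at hu
    have hunit : IsUnit (algebraMap 𝒪[F] O ϖ) := IsUnit.of_mul_eq_one _ hu
    exact hQmax.ne_top (Ideal.eq_top_of_isUnit_mem Q hϖOQ hunit)
  obtain ⟨w, e₀, hpe₀, hee⟩ := Nat.exists_eq_pow_mul_and_not_dvd he0 (ringChar 𝓀[F]) hp.ne_one
  have he₀ : 0 < e₀ := Nat.pos_of_ne_zero (by rintro rfl; rw [mul_zero] at hee; exact he0 hee)
  -- the `e₀`-th root `z` of `ϖ`, fixed by `σ`
  set z : AlgebraicClosure F := (kummerRoot F he₀ ϖ : AlgebraicClosure F) with hzdef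
  have hz : z ^ e₀ = algebraMap 𝒪[F] (AlgebraicClosure F) ϖ := coe_kummerRoot_pow F he₀ ϖ
  have hz0 : z ≠ 0 := coe_kummerRoot_ne_zero he₀ hϖ.ne_zero
  have hσz : σ • z = z := hσ.2 he₀ hpe₀ z hz
  -- everything in `F̄`: `πA = π`, `cA = c`, `uA = u`
  set πA : AlgebraicClosure F := ((π : E) : AlgebraicClosure F) with hπAdef
  set cA : AlgebraicClosure F := ((c : E) : AlgebraicClosure F) with hcAdef
  set uA : AlgebraicClosure F := (((u : O) : E) : AlgebraicClosure F) with huAdef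
  have hιcoe : ∀ x : O, ((ι x : absIntegers 𝒪[F] F) : AlgebraicClosure F) = ((x : E) : AlgebraicClosure F) :=
    fun x => rfl
  have hϖA : ((algebraMap 𝒪[F] O ϖ : E) : AlgebraicClosure F) = algebraMap 𝒪[F] (AlgebraicClosure F) ϖ := by
    rw [Subalgebra.coe_algebraMap, IsScalarTower.algebraMap_apply 𝒪[F] F E,
      IsScalarTower.algebraMap_apply 𝒪[F] F (AlgebraicClosure F)]
    rfl
  have hπA0 : πA ≠ 0 := by
    rw [hπAdef]
    exact_mod_cast (show (π : E) ≠ 0 from fun h => hπ0 (Subtype.ext h))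
  -- `σ • πA = cA * πA`
  have h1 : σ • πA = cA * πA := by
    have e1 : ((ι (τ • π) : absIntegers 𝒪[F] F) : AlgebraicClosure F) = σ • πA := by
      rw [hιτ, integralClosure.coe_smul, hιcoe]
    have e2 : ((ι (τ • π) : absIntegers 𝒪[F] F) : AlgebraicClosure F) = cA * πA := by
      rw [hιcoe, ← hc, hcAdef, hπAdef]
      push_cast
      rfl
    rw [← e1, e2]
  -- `πA ^ e = ϖ * uA`, so `y ^ e₀ = uA` for `y = πA ^ (p ^ w) / z`
  have h2 : πA ^ e = algebraMap 𝒪[F] (AlgebraicClosure F) ϖ * uA := by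
    have h := congrArg (fun t : O => ((t : E) : AlgebraicClosure F)) hu
    rw [← hϖA, hπAdef, huAdef]
    push_cast at h ⊢
    exact h.symm
  have hϖA0 : algebraMap 𝒪[F] (AlgebraicClosure F) ϖ ≠ 0 := by rw [← hz]; exact pow_ne_zero _ hz0
  set y : AlgebraicClosure F := πA ^ (ringChar 𝓀[F] ^ w) / z with hydef
  have hy : y ^ e₀ = uA := by
    rw [hydef, div_pow, ← pow_mul, ← hee, h2, hz, mul_div_cancel_left₀ _ hϖA0]
  have hyz : πA ^ (ringChar 𝓀[F] ^ w) = y * z := by rw [hydef, div_mul_cancel₀ _ hz0]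
  -- `y` is integral and not in `𝔓` (its `e₀`-th power is a unit of `\bar ℤ`)
  have huAint : IsIntegral 𝒪[F] uA := (ι (u : O)).2
  have hyint : IsIntegral 𝒪[F] y := IsIntegral.of_pow he₀ (by rw [hy]; exact huAint)
  set yS : absIntegers 𝒪[F] F := ⟨y, hyint⟩ with hySdef
  have hyS_pow : yS ^ e₀ = ι (u : O) := Subtype.ext (by
    rw [SubmonoidClass.coe_pow]
    exact hy)
  have hyS : yS ∉ absMaximalIdeal F := by
    intro hmem
    have h3 : ι (u : O) ∈ absMaximalIdeal F := by
      rw [← hyS_pow]; exact Ideal.pow_mem_of_mem _ hmem _ he₀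
    have h4 : IsUnit (ι (u : O)) := (Units.isUnit u).map ι
    exact hPmax.ne_top (Ideal.eq_top_of_isUnit_mem _ h3 h4)
  -- `σ • y = cA ^ (p ^ w) * y`
  have h5 : σ • y = cA ^ (ringChar 𝓀[F] ^ w) * y := by
    have lhs : σ • (πA ^ (ringChar 𝓀[F] ^ w)) = cA ^ (ringChar 𝓀[F] ^ w) * (y * z) := by
      rw [smul_pow', h1, mul_pow, hyz]
    have rhs : σ • (πA ^ (ringChar 𝓀[F] ^ w)) = σ • y * z := by
      rw [hyz, smul_mul', hσz]
    apply mul_right_cancel₀ hz0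
    rw [← rhs, lhs, mul_assoc]
  -- hence `(c ^ (p ^ w) - 1) * y ∈ 𝔓`, so `c ^ (p ^ w) - 1 ∈ Q`
  have h6 : c ^ (ringChar 𝓀[F] ^ w) - 1 ∈ Q := by
    have hmem : σ • yS - yS ∈ absMaximalIdeal F := hσ.1 yS
    have heq : σ • yS - yS = ι (c ^ (ringChar 𝓀[F] ^ w) - 1) * yS := Subtype.ext (by
      rw [AddSubgroupClass.coe_sub, integralClosure.coe_smul, MulMemClass.coe_mul, hιcoe]
      change σ • y - y = _ * y
      rw [h5, hcAdef]
      push_cast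
      ring)
    rw [heq] at hmem
    rcases hPmax.isPrime.mem_or_mem hmem with h | h
    · rwa [hQdef, Ideal.mem_comap]
    · exact absurd h hyS
  -- `c ≡ 1 (mod Q)`: the `p^w`-th power map of the residue field `O ⧸ Q` is injective
  have h7 : c - 1 ∈ Q := by
    haveI : CharP (O ⧸ Q) (ringChar 𝓀[F]) := charP_integralClosure_quotient F E
    haveI : ExpChar (O ⧸ Q) (ringChar 𝓀[F]) := ExpChar.prime hp
    have hck : (Ideal.Quotient.mk Q c) ^ (ringChar 𝓀[F] ^ w) = 1 := by
      rw [← map_pow, ← (Ideal.Quotient.mk Q).map_one, Ideal.Quotient.eq]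
      exact h6
    have hmk : Ideal.Quotient.mk Q c = 1 := by
      apply iterateFrobenius_inj (O ⧸ Q) (ringChar 𝓀[F]) w
      rw [iterateFrobenius_def, iterateFrobenius_def, one_pow, hck]
    rw [← (Ideal.Quotient.mk Q).map_one, Ideal.Quotient.eq] at hmk
    exact hmk
  -- `τ • π - π = (c - 1) π ∈ Q²`, and Serre's criterion
  have hτπ : τ • π - π ∈ Q ^ 2 := by
    rw [← hc, ← sub_one_mul, pow_two]
    exact Ideal.mul_mem_mul h7 hπQ
  exact mem_ramificationSubgroup_one_of_smul_uniformizer_sub_mem F E hπ hτI hτπ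

/-- **Discharge of `absWildInertia_isProP`: the wild inertia group `P_F` is pro-`p`.**  Given
`σ ∈ P_F` and an open subgroup `N ≤ Γ_F`: shrink `N` to an open normal subgroup (profiniteness
of `Γ_F`), factor `Γ_F → Γ_F/N` through a finite Galois `Gal(E/F)` (`exists_isGalois_ker_le`),
observe that `σ|_E` lies in the wild ramification group `G_1(E/F)`
(`absRestrictNormalHom_mem_ramificationSubgroup_one_of_mem_absWildInertia`), a `p`-group
(`isPGroup_ramificationSubgroup_one_of_isGalois`, Serre's Cor. 3), so `σ^{p^t}|_E = 1` and
`σ^{p^t} ∈ N`.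
Ref: Serre, *Local Fields*, Ch. IV §2, Prop. 7, Cor. 1 and Cor. 3; Serre, Invent. Math. 15
(1972), §1.3 (`I_p = Gal(K̄/K_t)` is pro-`p`, `K_t = ⋃ K_nr(π^{1/d})`).
[cite: SerreLocalFields1979, Ch. IV §2 Cor. 1 and Cor. 3 of Prop. 7] [cite: SerreInventiones1972, §1.3] -/
theorem absWildInertia_isProP_holds : absWildInertia_isProP F := by
  intro ϖ hϖ σ hσ N hN
  classical
  haveI : CompactSpace (absoluteGaloisGroup F) := absoluteGaloisGroup_compactSpace F
  obtain ⟨N', hN'⟩ := ProfiniteGrp.exist_openNormalSubgroup_sub_open_nhds_of_one hN (one_mem N)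
  suffices h : ∃ a : ℕ, σ ^ (ringChar 𝓀[F] ^ a) ∈ (N' : Subgroup (absoluteGaloisGroup F)) from
    h.imp fun a ha => hN' ha
  set M : Subgroup (absoluteGaloisGroup F) := (N' : Subgroup (absoluteGaloisGroup F)) with hM
  haveI hMn : M.Normal := N'.isNormal'
  haveI : DiscreteTopology (absoluteGaloisGroup F ⧸ M) := QuotientGroup.discreteTopology N'.isOpen
  let π : absoluteGaloisGroup F →ₜ* absoluteGaloisGroup F ⧸ M :=
    ⟨QuotientGroup.mk' M, QuotientGroup.continuous_mk⟩
  obtain ⟨E, hfin, hgal, hker⟩ := exists_isGalois_ker_le F π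
  haveI := hfin
  haveI := hgal
  have hG1 := isPGroup_ramificationSubgroup_one_of_isGalois F E
  have hmem := absRestrictNormalHom_mem_ramificationSubgroup_one_of_mem_absWildInertia F E hϖ hσ
  obtain ⟨t, ht⟩ := hG1 ⟨_, hmem⟩
  refine ⟨t, ?_⟩
  have h1 : σ ^ ringChar 𝓀[F] ^ t ∈ (absRestrictNormalHom (K := F) E).ker := by
    rw [MonoidHom.mem_ker, map_pow]
    exact congrArg Subtype.val ht
  have h2 := hker h1
  rw [MonoidHom.mem_ker] at h2
  exact (QuotientGroup.eq_one_iff _).mp h2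

end Discharge

end Literature.NumberTheory.GaloisRepresentations
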